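/-
Origin: HOME/pub-hodgecm-prl1/lean/Prl1/CorCMTheta.lean — session planner-pub-hodgecm-prl1-0 (unit pub-hodgecm-prl1).
Intended final place: `HodgeCM/Assembly/CorCMTheta.lean` (imports `HodgeCM.Proofs.RealisationConstruction`,
`HodgeCM.Assembly.CorCM`).
Origin: expansion seat `planner-pub-hodgecm-prl1-0` (unit pub-hodgecm-prl1), handover v1 2026-08-18T03:12:21Z (`HOME/pub-hodgecm-prl1/lean/Prl1/CorCMTheta.lean`, md5 cf6bd024);
landed by the gen-5 packager as `HodgeCM/Assembly/CorCMTheta.lean` (module renamed `Prl1.CorCMTheta` → `HodgeCM.Assembly.CorCMTheta`, `import Prl1.*` lines renamed accordingly; body otherwise verbatim).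
-/
import Summits.HodgeConjecture.HodgeCM.Proofs.RealisationConstruction
import Summits.HodgeConjecture.HodgeCM.Assembly.CorCM

set_option autoImplicit false

/-!
# COR-CM and PerL with the realisation input replaced by the theta model

The two realisation fields of `HodgeCM.Universe.OpenInputs` (`realisation_perL`, `realisation_face`) are
DISCHARGED by the construction `HodgeCM.Universe.ThetaModel.nonempty_thetaRealisation` relative to:

* `T : U.ThetaModel`, `A : T.Inputs` — the automorphic primitives and their ten named inputs (2 print facts, 2 design constraints, 6 PerL open inputs; record named `ThetaModel.Axioms` until run 17)
  (`HodgeCM.Automorphic.ThetaModel`, `HodgeCM.Automorphic.ThetaFacts`; PRINT: `embCover`, `innerEmb`; DESIGN (definitional, no citation claimed): `kappaConj`, `frameSignConj`;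
  OPEN (PerL-internal, prover-owned) = PerL v5's own lemmas with the obstruction named in each docstring: `thetaSub` (L3.3(a)+Prop 2.2),
  `thetaWedge` (Prop 4.3), `thetaGen12`, `thetaReal34` (L3.5), `chars` (L4.2(b)), `occ` (L4.1(c)));
* `U.Fact_hodgeRiemann20` (PRINT, Hodge–Riemann for `H^{2,0}` of a surface);
* `HodgeCM.LevelDirected` (PROVABLE: `Γ ∩ Γ'` is a level);
* `HodgeCM.Lemma33bLandherr` (the named Landherr classification target; PROVED since run 22 —
  `HodgeCM.lemma33bLandherr_holds`; the `hL` binders below are discharged in `HodgeCM/Proofs/LandherrDischarge.lean`).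

`OpenInputsTheta` is the corresponding reduced record and `openInputs_of_theta` recovers `U.OpenInputs` from it,
so every existing headline theorem applies verbatim.
-/

noncomputable section

namespace HodgeCM

namespace Assembly

variable (U : Universe)

/-- **PerL** (Hodge for the `per-L` Weil classes) from the model facts, the theta model and the three residual
named inputs `Fact_hodgeRiemann20`, `LevelDirected`, `Lemma33bLandherr`. -/
theorem perL_theta (M : U.ModelAxioms) (T : U.ThetaModel) (A : T.Inputs) (hHR : U.Fact_hodgeRiemann20)
    (hLD : LevelDirected) (hL : Lemma33bLandherr) : U.PerL :=
  perL U M (T.realisationExistsPerL_of M A hHR hLD hL)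

/-- **rfwf Thm 4.1** from the theta model. -/
theorem periodThmF_theta (M : U.ModelAxioms) (T : U.ThetaModel) (A : T.Inputs) (hHR : U.Fact_hodgeRiemann20)
    (hLD : LevelDirected) (hL : Lemma33bLandherr) : U.PeriodThmF :=
  periodThmF U M (T.realisationExistsFace_of M A hHR hLD hL)

/-- **COR-CM** with the realisation input constructed from the theta model: the remaining named open inputs
are `T.Inputs` (ten automorphic inputs: 2 print, 2 design, 6 PerL open), `Fact_hodgeRiemann20`, `LevelDirected`, `Lemma33bLandherr`,
`PohlmannSpan`, `Qw8Sufficiency`. -/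
theorem COR_CM_theta (M : U.ModelAxioms) (T : U.ThetaModel) (A : T.Inputs) (hHR : U.Fact_hodgeRiemann20)
    (hLD : LevelDirected) (hL : Lemma33bLandherr) (hP : U.PohlmannSpan) (hQ : U.Qw8Sufficiency) :
    U.HC_CM :=
  COR_CM U M (T.realisationExistsFace_of M A hHR hLD hL) hP hQ

/-- The record of open inputs AFTER this expansion step: the two `RealisationExists*` fields of
`U.OpenInputs` are replaced by the theta-model axioms and the three residual named inputs. -/
structure OpenInputsTheta (T : U.ThetaModel) : Prop where
  /-- the ten automorphic facts of `HodgeCM.Automorphic.ThetaFacts` -/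
  theta : T.Inputs
  /-- Hodge–Riemann for holomorphic 2-forms on a surface (PRINT) -/
  hodgeRiemann20 : U.Fact_hodgeRiemann20
  /-- levels are directed under inclusion (PROVABLE) -/
  levelDirected : LevelDirected
  /-- Landherr's classification of hermitian planes over a CM field (target of the Landherr seat) -/
  landherr : Lemma33bLandherr
  /-- Pohlmann 1968 (unchanged) -/
  pohlmann_span : U.PohlmannSpan
  /-- [QW8] Thm 2.5 + Milne 1999 (unchanged) -/
  qw8_sufficiency : U.Qw8Sufficiency

/-- The old record from the new one: both realisation inputs are now theorems of the theta model. -/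
theorem openInputs_of_theta (M : U.ModelAxioms) (T : U.ThetaModel) (I : OpenInputsTheta U T) :
    U.OpenInputs where
  realisation_perL := T.realisationExistsPerL_of M I.theta I.hodgeRiemann20 I.levelDirected I.landherr
  realisation_face := T.realisationExistsFace_of M I.theta I.hodgeRiemann20 I.levelDirected I.landherr
  pohlmann_span := I.pohlmann_span
  qw8_sufficiency := I.qw8_sufficiency

/-- **COR-CM from the reduced record.** -/
theorem COR_CM_of_openInputsTheta (M : U.ModelAxioms) (T : U.ThetaModel) (I : OpenInputsTheta U T) :
    U.HC_CM :=
  COR_CM_of_openInputs U M (openInputs_of_theta U M T I)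

end Assembly

end HodgeCM

end
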